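import Summits.KontsevichZagierPeriods.KontsevichZagierPeriods.Theorems.MzvKernelInKZ.Negative.Divergence

/-!
# `MzvKernelInKZ` (stmt-KontsevichZagierPeriods-3914): negative side — the all-weights transfer theorem; strength

Companion of `Negative/Divergence.lean`.  §1 The all-weights **TRANSFER THEOREM** `cruxAdm_of_family`:
if a family of admissible words (any index type, all weights mixed — e.g. the empty word with the
Hoffman words) has `ℚ`-linearly independent VALUES and spans every admissible word representation
MODULO RELATIONS with rational coefficients, the crux holds on the admissible closure; the crux is
equivalent to its admissible form (`crux_iff_cruxAdm`), and conversely forces the spanning half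
(`sub_sum_mem_relations_of_cruxAdm`).  For the Hoffman family the independence hypothesis is the
Hoffman-basis form of Zagier's conjecture (open) and the spanning hypothesis is the move-chain
statement `HoffmanSpanInKZ` of route CoactionDevissage; nothing else is needed.
§2 STRENGTH: the crux together with independence IN THE CALCULUS of the four lowest base classes
`[pt,·], [Δ₂,·ω₀₁], [Δ₃,·ω₀₀₁], [Δ₄,·ω₀₀₀₁]` (what motivic soundness of the moves predicts) already
implies `ζ(3) ∉ ℚ + ℚπ² + ℚπ⁴` (open): a proof of the crux is transcendence-complete on its sector.

Sources: D. Zagier (1994), §9 (dimension conjecture); F. Brown, *Mixed Tate motives over ℤ*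
(2012), Thm. 1.1 (Hoffman basis); M. Kontsevich, D. Zagier, *Periods* (2001), §1.2. -/

noncomputable section

namespace Summit.KontsevichZagierPeriods.MzvKernelInKZ.Negative

open Set MeasureTheory MvPolynomial
open Literature.NumberTheory.Transcendental
open Summit.KontsevichZagierPeriods.KontsevichZagierPeriods.Theses.LinRedNormalForm (MzvKernelInKZ)

section Transfer

/-- All admissible generators, all weights. [folklore] -/
def genSetAdmAll : Set KZ.FormalRep :=
  {x | ∃ (w : ℕ) (ε : Fin w → Bool) (q : ℚ) (s : KZ.IntegralRep w),
    Adm ε ∧ s.domain = simplex w ∧ EqOn s.integrand (wordFun ε q) s.domain ∧ x = KZ.of s}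

/-- The crux on the admissible closure (non-admissible generators are zero representations). -/
def CruxAdm : Prop :=
  ∀ c ∈ AddSubgroup.closure genSetAdmAll, KZ.eval c = 0 → c ∈ KZ.relations

/-- Admissible generators are generators. [folklore] -/
theorem genSetAdmAll_subset_genSet : genSetAdmAll ⊆ genSet := by
  rintro x ⟨w, ε, q, s, -, hd, hi, rfl⟩
  exact ⟨w, ε, q, s, hd, hi, rfl⟩

/-- The admissible form is a special case of the crux. [folklore] -/
theorem cruxAdm_of_crux (h : MzvKernelInKZ) : CruxAdm :=
  fun c hc => h c (AddSubgroup.closure_mono genSetAdmAll_subset_genSet hc)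

/-- Canonical word representations with admissible letters are admissible generators (all weights). [folklore] -/
theorem of_wordRep_mem_genSetAdmAll {w : ℕ} (ε : Fin w → Bool) (q : ℚ) (hε : Adm ε) :
    KZ.of (wordRep ε q hε) ∈ genSetAdmAll :=
  ⟨w, ε, q, wordRep ε q hε, hε, rfl, fun _ _ => rfl, rfl⟩

/-- The class map to `FormalRep ⧸ relations` (the group of "rules-periods"). [folklore] -/
def cls : KZ.FormalRep →+ KZ.FormalRep ⧸ KZ.relations := QuotientAddGroup.mk' KZ.relations

/-- A class vanishes iff the representative is a relation. [folklore] -/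
theorem cls_eq_zero_iff {c : KZ.FormalRep} : cls c = 0 ↔ c ∈ KZ.relations :=
  QuotientAddGroup.eq_zero_iff c

/-- Two classes agree iff the representatives differ by a relation. [folklore] -/
theorem cls_eq_cls_iff {c c' : KZ.FormalRep} : cls c = cls c' ↔ c - c' ∈ KZ.relations := by
  rw [← sub_eq_zero, ← map_sub, cls_eq_zero_iff]

/-- Evaluation descends to the quotient (soundness). [folklore] -/
def evalQ : KZ.FormalRep ⧸ KZ.relations →+ ℝ :=
  QuotientAddGroup.lift KZ.relations KZ.eval KZ.relations_le_ker_eval_holds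

/-- `evalQ (cls c) = eval c` (definitional). [folklore] -/
@[simp] theorem evalQ_cls (c : KZ.FormalRep) : evalQ (cls c) = KZ.eval c := rfl

variable {ι : Type*} {wt : ι → ℕ} (B : ∀ j, Fin (wt j) → Bool) (hB : ∀ j, Adm (B j))

/-- The coefficient map of one base word, `q ↦ class of [Δ, q ω_{Bⱼ}]`: ADDITIVE, by integrand
additivity. [folklore] -/
def coefHom (j : ι) : ℚ →+ KZ.FormalRep ⧸ KZ.relations where
  toFun q := cls (KZ.of (wordRep (B j) q (hB j)))
  map_zero' := cls_eq_zero_iff.mpr (of_wordRep_zero_mem_relations _ _)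
  map_add' q₁ q₂ := by
    rw [← map_add, cls_eq_cls_iff, ← sub_sub]
    exact of_wordRep_add _ _ _ _

/-- `coefHom B hB j q` is the class of `[Δ, q ω_{Bⱼ}]` (definitional). [folklore] -/
@[simp] theorem coefHom_apply (j : ι) (q : ℚ) :
    coefHom B hB j q = cls (KZ.of (wordRep (B j) q (hB j))) := rfl

/-- The normal-form map on finitely supported rational coefficient vectors. [folklore] -/
def nfHom : (ι →₀ ℚ) →+ KZ.FormalRep ⧸ KZ.relations := Finsupp.liftAddHom (coefHom B hB)

/-- `nfHom` on a finitely supported vector is the sum of the coefficient classes. [folklore] -/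
theorem nfHom_apply (l : ι →₀ ℚ) :
    nfHom B hB l = l.sum fun j q => cls (KZ.of (wordRep (B j) q (hB j))) :=
  Finsupp.liftAddHom_apply _ _

/-- The class of a rational combination of base representations is its normal form. [folklore] -/
theorem cls_finsuppSum (l : ι →₀ ℚ) :
    cls (l.sum fun j q => KZ.of (wordRep (B j) q (hB j))) = nfHom B hB l := by
  rw [map_finsuppSum, nfHom_apply]

/-- The value of a normal form: `∑ⱼ qⱼ · value [Δ, ω_{Bⱼ}]`. [folklore] -/
theorem evalQ_nfHom (l : ι →₀ ℚ) :
    evalQ (nfHom B hB l) = l.sum fun j q => (q : ℝ) * (wordRep (B j) 1 (hB j)).value := by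
  rw [nfHom_apply, map_finsuppSum]
  exact Finsupp.sum_congr fun j _ => by rw [evalQ_cls, KZ.eval_of, value_wordRep]

/-- Rational rescaling of a representative of a normal form. [folklore] -/
theorem cls_scale_finsuppSum (q : ℚ) (a : ι →₀ ℚ) :
    cls (KZ.scale (q : ℝ) (isAlgebraic_ratCast q) (a.sum fun j r => KZ.of (wordRep (B j) r (hB j)))) =
      nfHom B hB (q • a) := by
  rw [map_finsuppSum, map_finsuppSum, nfHom_apply, Finsupp.sum_smul_index]
  · refine Finsupp.sum_congr fun j _ => ?_
    rw [KZ.scale_of, cls_eq_cls_iff]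
    exact of_sub_of_mem_relations_of_eqOn rfl fun t _ => by
      simp only [KZ.IntegralRep.integrand_constMul, wordRep_integrand, wordFun, Rat.cast_mul]
      ring
  · intro j
    exact cls_eq_zero_iff.mpr (of_wordRep_zero_mem_relations _ _)

/-- **TRANSFER THEOREM** (independent values + spanning inside the calculus ⇒ the crux on the
admissible closure). [folklore] -/
theorem cruxAdm_of_family
    (hind : LinearIndependent ℚ fun j => (wordRep (B j) 1 (hB j)).value)
    (hspan : ∀ (w : ℕ) (ε : Fin w → Bool) (hε : Adm ε), ∃ a : ι →₀ ℚ,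
      KZ.of (wordRep ε 1 hε) - a.sum (fun j r => KZ.of (wordRep (B j) r (hB j))) ∈ KZ.relations) :
    CruxAdm := by
  intro c hc hc0
  have key : ∃ l : ι →₀ ℚ, cls c = nfHom B hB l := by
    clear hc0
    induction hc using AddSubgroup.closure_induction with
    | mem x hx =>
      obtain ⟨w, ε, q, s, hε, hd, hi, rfl⟩ := hx
      obtain ⟨a, ha⟩ := hspan w ε hε
      refine ⟨q • a, ?_⟩
      have h1 : cls (KZ.of s) = cls (KZ.of (wordRep ε q hε)) :=
        cls_eq_cls_iff.mpr (of_sub_of_wordRep_mem_relations hε s hd hi)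
      have h2 : cls (KZ.of (wordRep ε q hε)) =
          cls (KZ.scale (q : ℝ) (isAlgebraic_ratCast q) (KZ.of (wordRep ε 1 hε))) := by
        rw [KZ.scale_of, cls_eq_cls_iff]
        exact of_sub_of_mem_relations_of_eqOn rfl fun t _ => by
          simp only [KZ.IntegralRep.integrand_constMul, wordRep_integrand, wordFun, Rat.cast_one]
          ring
      have h3 : cls (KZ.scale (q : ℝ) (isAlgebraic_ratCast q) (KZ.of (wordRep ε 1 hε))) =
          cls (KZ.scale (q : ℝ) (isAlgebraic_ratCast q)
            (a.sum fun j r => KZ.of (wordRep (B j) r (hB j)))) := by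
        rw [cls_eq_cls_iff, ← map_sub]
        exact KZ.scale_mem_relations _ _ ha
      rw [h1, h2, h3, cls_scale_finsuppSum]
    | zero => exact ⟨0, by simp⟩
    | add x y _ _ ihx ihy =>
      obtain ⟨l₁, h₁⟩ := ihx
      obtain ⟨l₂, h₂⟩ := ihy
      exact ⟨l₁ + l₂, by rw [map_add, map_add, h₁, h₂]⟩
    | neg x _ ih =>
      obtain ⟨l, h⟩ := ih
      exact ⟨-l, by rw [map_neg, map_neg, h]⟩
  obtain ⟨l, hl⟩ := key
  have hev : evalQ (nfHom B hB l) = 0 := by rw [← hl, evalQ_cls, hc0]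
  have hl0 : l = 0 := by
    refine linearIndependent_iff.mp hind l ?_
    rw [Finsupp.linearCombination_apply]
    rw [evalQ_nfHom] at hev
    simpa [Rat.smul_def] using hev
  rw [hl0, map_zero, cls_eq_zero_iff] at hl
  exact hl

/-- Cheap converse: the crux forces the spanning half whenever the values span
(e.g. Brown's `hoffmanSpan_eq_mzvSpace`). [folklore] -/
theorem sub_sum_mem_relations_of_cruxAdm (h : CruxAdm) {w : ℕ} {ε : Fin w → Bool} (hε : Adm ε)
    (a : ι →₀ ℚ)
    (hval : (wordRep ε 1 hε).value = a.sum fun j r => (r : ℝ) * (wordRep (B j) 1 (hB j)).value) :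
    KZ.of (wordRep ε 1 hε) - a.sum (fun j r => KZ.of (wordRep (B j) r (hB j))) ∈ KZ.relations := by
  have hsum : (a.sum fun j r => KZ.of (wordRep (B j) r (hB j))) ∈ AddSubgroup.closure genSetAdmAll :=
    sum_mem fun j _ => AddSubgroup.subset_closure (of_wordRep_mem_genSetAdmAll _ _ _)
  refine h _ (sub_mem (AddSubgroup.subset_closure (of_wordRep_mem_genSetAdmAll _ _ _)) hsum) ?_
  rw [map_sub, KZ.eval_of, hval, map_finsuppSum, sub_eq_zero]
  exact Finsupp.sum_congr fun j _ => by rw [KZ.eval_of, value_wordRep (B j) (a j)]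

end Transfer
section AdmAll

variable {w : ℕ}

/-- All-weights version: every element of the crux's closure is congruent to one of the admissible
closure. [folklore] -/
theorem exists_admAll_congr {c : KZ.FormalRep} (hc : c ∈ AddSubgroup.closure genSet) :
    ∃ c' ∈ AddSubgroup.closure genSetAdmAll, c - c' ∈ KZ.relations := by
  induction hc using AddSubgroup.closure_induction with
  | mem x hx =>
    obtain ⟨w, ε, q, s, hd, hi, rfl⟩ := hx
    by_cases hε : Adm ε
    · exact ⟨KZ.of s, AddSubgroup.subset_closure ⟨w, ε, q, s, hε, hd, hi, rfl⟩, by simp⟩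
    · exact ⟨0, zero_mem _, by simpa using of_mem_relations_of_not_adm s hd hi hε⟩
  | zero => exact ⟨0, zero_mem _, by simp⟩
  | add x y _ _ ihx ihy =>
    obtain ⟨c₁, h₁, e₁⟩ := ihx
    obtain ⟨c₂, h₂, e₂⟩ := ihy
    refine ⟨c₁ + c₂, add_mem h₁ h₂, ?_⟩
    have : x + y - (c₁ + c₂) = (x - c₁) + (y - c₂) := by abel
    rw [this]
    exact add_mem e₁ e₂
  | neg x _ ih =>
    obtain ⟨c', h', e'⟩ := ih
    refine ⟨-c', neg_mem h', ?_⟩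
    have : -x - -c' = -(x - c') := by abel
    rw [this]
    exact neg_mem e'

/-- **THE CRUX IS EQUIVALENT TO ITS ADMISSIBLE FORM** — so the transfer theorem `cruxAdm_of_family`
(§5) proves the crux itself from (independence of values) ∧ (spanning inside the calculus). [folklore] -/
theorem crux_iff_cruxAdm : MzvKernelInKZ ↔ CruxAdm := by
  refine ⟨cruxAdm_of_crux, fun h c hc hc0 => ?_⟩
  obtain ⟨c', hc', e⟩ := exists_admAll_congr hc
  have hev : KZ.eval c' = 0 := by
    have := (AddMonoidHom.mem_ker).1 (KZ.relations_le_ker_eval_holds e)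
    rwa [map_sub, hc0, zero_sub, neg_eq_zero] at this
  have := add_mem e (h c' hc' hev)
  simpa using this

end AdmAll

/-! ## §2 Strength: what any PROOF of the crux must contain -/

section Strength

/-- Independence IN THE CALCULUS of the four lowest base classes (rational-coefficient form). -/
def LowBaseIndependentInCalculus : Prop :=
  ∀ a b c d : ℚ,
    KZ.of (emptyWordRep a) + KZ.of (wordRep ω2 b adm_ω2) + KZ.of (wordRep ω3 c adm_ω3) +
        KZ.of (wordRep ω4 d adm_ω4) ∈ KZ.relations →
      a = 0 ∧ b = 0 ∧ c = 0 ∧ d = 0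

/-- **Crux + independence in the calculus ⇒ `ζ(3) ∉ ℚ + ℚπ² + ℚπ⁴`** (open). [folklore] -/
theorem zeta_three_not_mem_span_of_crux (h : MzvKernelInKZ) (hI : LowBaseIndependentInCalculus)
    (a b d : ℚ) : multipleZeta [3] ≠ a + b * Real.pi ^ 2 + d * Real.pi ^ 4 := by
  intro h3
  -- the vanishing combination `[pt,a] + [Δ₂, 6b·ω] + [Δ₃, (−1)·ω] + [Δ₄, 90d·ω]`
  set c : KZ.FormalRep := KZ.of (emptyWordRep a) + KZ.of (wordRep ω2 (6 * b) adm_ω2) +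
    KZ.of (wordRep ω3 (-1) adm_ω3) + KZ.of (wordRep ω4 (90 * d) adm_ω4) with hc
  have hmem : c ∈ AddSubgroup.closure genSet := by
    refine add_mem (add_mem (add_mem ?_ ?_) ?_) ?_ <;>
      exact AddSubgroup.subset_closure (of_wordRep_mem_genSet _ _ _)
  have hev : KZ.eval c = 0 := by
    simp only [hc, map_add, KZ.eval_of, value_emptyWordRep]
    rw [value_wordRep ω2 (6 * b), value_wordRep ω3 (-1), value_wordRep ω4 (90 * d), value_ω2,
      value_ω3, value_ω4, h3]
    push_cast
    ring
  have hrel := h c hmem hev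
  have := (hI a (6 * b) (-1) (90 * d) hrel).2.2.1
  norm_num at this

end Strength

end Summit.KontsevichZagierPeriods.MzvKernelInKZ.Negative
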